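/-
Copyright (c) 2026 the pub-hodgecm-mathlib formalisation cell (harness21).  Prover seat hodgecm-mathlib-K2E3-p17 (g7), Track B «K2-LIT» ∕ h413
(`stmt-HodgeConjecture-24833`), line `K2_E3_EllipticInputs`, unit U12 §L, road «GL-[M6]-sc» (owner K2E3-p23 (g5)), MEMO «M6sc-BLUEPRINT v4» §2 brick T15-log,
steps (b) + (c): «LOCAL INTEGRABILITY PASSES FROM `M_n(F)` TO `GL_n(F)`, AND FROM `G` TO `G'` ALONG A COVERING HOMOMORPHISM».  2026-09-04.
-/
import Summits.HodgeConjecture.HodgeConjecture.Theorems.K2E3CoveringHomLocalHaar   -- ★ B0b p857885: `exists_map_restrict_smul_eq`, `injOn_of_forall_eq_one`, `setLIntegral_comp_eq_of_map_restrict_eq`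
import Literature.NumberTheory.Weil1964.GLnHaarOfAddHaar                          -- ★ `isHaarMeasure_glHaar`, `measurableEmbedding_generalLinearGroup_val`, `continuousOn_normAbs_det_inv`, `measurable_glDensity`
import Literature.NumberTheory.Automorphic.TateLocalZetaShells                    -- ★ `secondCountableTopology_localField`
import Mathlib.MeasureTheory.Function.LocallyIntegrable
import HarnessLib

/-!
# K2_E3 road (h413), §L — brick T15-log, steps (b) and (c): transport of local integrability `M_n(F) ⇝ GL_n(F)` and `G ⇝ G'` (covering homomorphism)

Cell `pub/hodgecm-mathlib` (D-0151), Track B, seat K2E3-p17 (g7); MEMO «M6sc-BLUEPRINT v4» (K2E3-p23 (g5)) §0.3 ∕ §2 «T15-log (b), (c)» (road owner RULINGS #12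
(M12-2)).  `--supports stmt-HodgeConjecture-24833 --as helper`; THEOREMS ONLY (no definition ∕ instance ∕ notation ∕ named fact ∕ `sorry`); never imports `Cruxes/…/Lines`.
COUNT-NEUTRAL.  Consumers: the T15 weight `|D♮|^{-1/2}(1+|log|D♮||)^κ` of the ASM of `sig_K2E3GL3ModUniformizerNonEllEstimates` is proved locally integrable on the
Lie algebra (★ `K2E3GL3SplitDiscriminantLocIntegrable` + mixed twin), moved to `GL₃(F)` by §2 and to `G' = GL₃(F) ⧸ ϖ^ℤ` by §1.

THE MATHEMATICS.  §1 (c): `p : G →* G'` a continuous open SURJECTIVE homomorphism of locally compact groups (`G'` second countable), `V ≤ G` an open subgroup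
with `V ∩ ker p = {1}`, `μ`, `μ'` Haar measures.  ★ B0b gives ONE `c ∈ (0,∞)` with `p_*(μ|_{gV}) = c·μ'|_{p(g)p(V)}` for all `g`.  If `W ∘ p` is locally
`μ`-integrable and `W` is a.e.-strongly measurable, then `W` is locally `μ'`-integrable: at `y = p(g)` take a compact neighbourhood `K ∋ g`, `U = K° ∩ gV`; then
`p(U)` is an open neighbourhood of `y` and `c ∫_{p(U)} ‖W‖ = ∫_U ‖W ∘ p‖ ≤ ∫_K ‖W ∘ p‖ < ∞` (`p` is injective on `gV`).  §2 (b): every Haar measure `ρ` of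
`GL_n(F)` is `a·‖det X‖_F^{-n} dX` through `Units.val` (★ `isHaarMeasure_glHaar` + uniqueness); the density is continuous, hence bounded, on compact subsets of
the open set `{X | IsUnit X}`, so a function `G` locally `dX`-integrable ON `{IsUnit}` gives `g ↦ G(↑g)` locally `ρ`-integrable on `GL_n(F)`
(`∫_{↑g ∈ K} ‖G ↑g‖ dρ ≤ a · max_K ‖det‖⁻ⁿ · ∫_K ‖G‖ dX`).
[WeilBNT1967, Ch. I §4, Ch. II §5] [HarishChandra1970, Part I §1 (passage `G ↔ G/Z`), Part V §6 Thm. 15] [Bourbaki, *Intégration* VII §2 n° 7]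
HONEST LABEL: HC_CM is proved only modulo the 7 printed citations (2 remaining named inputs: hLiu418 = stmt-HodgeConjecture-24832, h413 = stmt-HodgeConjecture-24833)
until rung 0 closes; count-neutral helper.

## Mathlib ∕ tree search
Tree: ★ B0b `K2E3CoveringHomLocalHaar.{exists_map_restrict_smul_eq, injOn_of_forall_eq_one, setLIntegral_comp_eq_of_map_restrict_eq}`, ★ `Weil1964.GLnHaarOfAddHaar.{isHaarMeasure_glHaar,
measurableEmbedding_generalLinearGroup_val, continuousOn_normAbs_det_inv, measurable_glDensity}`, ★ `isOpenEmbedding_generalLinearGroup_val`, ★ `secondCountableTopology_localField`.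
Mathlib: `LocallyIntegrable`, `IntegrableAtFilter`, `LocallyIntegrable.integrableOn_isCompact`, `LocallyIntegrableOn.integrableOn_compact_subset`, `exists_compact_mem_nhds`,
`exists_compact_subset`, `AEStronglyMeasurable.mono_ac`, `AEStronglyMeasurable.comp_measurable`, `MeasurableEmbedding.{lintegral_map, restrict_map, map_comap}`,
`isMulLeftInvariant_eq_smul`, `restrict_withDensity`, `lintegral_withDensity_le_lintegral_mul`, `withDensity_absolutelyContinuous`, `IsCompact.exists_isMaxOn`.
Dedup: `rg "locallyIntegrable_of_locallyIntegrable_comp|locallyIntegrable_comp_coe|LocallyIntegrable.*Units.val"` over Literature∕Summits — no hits.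

## References
* [WeilBNT1967] A. Weil, *Basic Number Theory* (1967), Ch. I §4 (Haar measure of `GL_n`), Ch. II §5 (Haar measure and local isomorphisms).
* [HarishChandra1970] Harish-Chandra (van Dijk), *Harmonic Analysis on Reductive p-adic Groups*, LNM 162 (1970), Part I §1, Part V §6 Thm. 15.
-/

set_option autoImplicit false
set_option linter.dupNamespace false

noncomputable section

open MeasureTheory MeasureTheory.Measure Set Function Topology Filter
open scoped NNReal ENNReal Pointwise MatrixGroups
open Summit.HodgeConjecture.HodgeConjecture.Cruxes.H413.K2E3CoveringHomLocalHaar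

namespace Summit.HodgeConjecture.HodgeConjecture.Cruxes.H413.K2E3HaarLocallyIntegrableTransport

/-! ## §1  (c) Local integrability descends along a covering homomorphism -/

section Covering

variable {G G' : Type*} [Group G] [TopologicalSpace G] [IsTopologicalGroup G] [MeasurableSpace G] [BorelSpace G] [LocallyCompactSpace G]
  [Group G'] [TopologicalSpace G'] [IsTopologicalGroup G'] [LocallyCompactSpace G'] [SecondCountableTopology G']
  [MeasurableSpace G'] [BorelSpace G']

omit [TopologicalSpace G] [IsTopologicalGroup G] [MeasurableSpace G] [BorelSpace G] [LocallyCompactSpace G] [TopologicalSpace G'] [IsTopologicalGroup G']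
  [LocallyCompactSpace G'] [SecondCountableTopology G'] [MeasurableSpace G'] [BorelSpace G'] in
/-- `p(g · V) = p(g) · p(V)` for a homomorphism `p`. [folklore] -/
theorem image_smul_coe_eq (p : G →* G') (V : Subgroup G) (g : G) : p '' (g • (V : Set G)) = p g • (p '' (V : Set G)) := by
  ext y
  constructor
  · rintro ⟨x, ⟨v, hv, rfl⟩, rfl⟩
    exact ⟨p v, ⟨v, hv, rfl⟩, by simp [smul_eq_mul, map_mul]⟩
  · rintro ⟨_, ⟨v, hv, rfl⟩, rfl⟩
    exact ⟨g * v, ⟨v, hv, rfl⟩, by simp [smul_eq_mul, map_mul]⟩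

/-- **(c) LOCAL INTEGRABILITY DESCENDS ALONG A COVERING HOMOMORPHISM.**  `p : G →* G'` continuous, open, surjective; `V ≤ G` open with `V ∩ ker p = {1}`;
`μ`, `μ'` Haar.  If `W` is a.e.-strongly measurable for `μ'` and `W ∘ p` is locally `μ`-integrable, then `W` is locally `μ'`-integrable.
[cite: WeilBNT1967, Ch. II §5] [cite: HarishChandra1970, Part I §1] -/
theorem locallyIntegrable_of_locallyIntegrable_comp (p : G →* G') (hpc : Continuous p) (hpo : IsOpenMap p) (hps : Function.Surjective p)
    (V : Subgroup G) (hVo : IsOpen (V : Set G)) (hV : ∀ x ∈ V, p x = 1 → x = 1)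
    (μ : Measure G) [μ.IsHaarMeasure] (μ' : Measure G') [μ'.IsHaarMeasure]
    {E : Type*} [NormedAddCommGroup E] {W : G' → E} (hWm : AEStronglyMeasurable W μ') (hW : LocallyIntegrable (fun x => W (p x)) μ) :
    LocallyIntegrable W μ' := by
  classical
  obtain ⟨c, hc, hmap⟩ := exists_map_restrict_smul_eq p hpc hpo V hVo hV μ μ'
  have hpm : Measurable p := hpc.measurable
  have hc0 : (c : ℝ≥0∞) ≠ 0 := ENNReal.coe_ne_zero.2 hc.ne'
  -- a strongly measurable version of `W`
  set W' : G' → E := hWm.mk W with hW'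
  have hW'm : StronglyMeasurable W' := hWm.stronglyMeasurable_mk
  have hWW' : W =ᵐ[μ'] W' := hWm.ae_eq_mk
  intro y
  obtain ⟨g, rfl⟩ := hps y
  obtain ⟨K, hK, hKg⟩ := exists_compact_mem_nhds g
  set U : Set G := interior K ∩ g • (V : Set G) with hU
  have hUo : IsOpen U := isOpen_interior.inter (hVo.smul g)
  have hgU : g ∈ U := ⟨mem_interior_iff_mem_nhds.2 hKg, ⟨1, V.one_mem, by simp⟩⟩
  have hUV : U ⊆ g • (V : Set G) := inter_subset_right
  have hUK : U ⊆ K := inter_subset_left.trans interior_subset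
  have hpUo : IsOpen (p '' U) := hpo U hUo
  refine ⟨p '' U, hpUo.mem_nhds (mem_image_of_mem p hgU), hWm.restrict, ?_⟩
  -- `∫_{p(U)} ‖W‖ₑ dμ' < ∞`
  show ∫⁻ y in p '' U, ‖W y‖ₑ ∂μ' < ∞
  set φ : G' → ℝ≥0∞ := (p '' U).indicator fun y => ‖W' y‖ₑ with hφ
  have hφm : Measurable φ := hW'm.enorm.indicator hpUo.measurableSet
  -- (i) replace `W` by `W'` and pass to the indicator
  have h1 : ∫⁻ y in p '' U, ‖W y‖ₑ ∂μ' = ∫⁻ y in p g • (p '' (V : Set G)), φ y ∂μ' := by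
    have hae : ∀ᵐ y ∂(μ'.restrict (p '' U)), ‖W y‖ₑ = ‖W' y‖ₑ := by
      filter_upwards [ae_restrict_of_ae hWW'] with y hy
      rw [hy]
    rw [lintegral_congr_ae hae, ← lintegral_indicator hpUo.measurableSet]
    refine (setLIntegral_eq_of_support_subset ?_).symm
    refine (support_indicator_subset).trans ?_
    rw [← image_smul_coe_eq]
    exact image_mono hUV
  -- (ii) substitute along `p` on the coset `g V`
  have h2 : ∫⁻ x in g • (V : Set G), φ (p x) ∂μ = (c : ℝ≥0∞) * ∫⁻ y in p g • (p '' (V : Set G)), φ y ∂μ' :=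
    setLIntegral_comp_eq_of_map_restrict_eq hpm (hmap g) φ hφm
  -- (iii) on `g V`, `φ ∘ p = 1_U · ‖W' ∘ p‖ₑ` (`p` is injective on `g V`)
  have hinj : Set.InjOn p (g • (V : Set G)) := by
    rintro _ ⟨v, hv, rfl⟩ _ ⟨v', hv', rfl⟩ h
    simp only [smul_eq_mul, map_mul] at h
    have h' : p v = p v' := mul_left_cancel h
    have := injOn_of_forall_eq_one p V hV hv hv' h'
    simp [this]
  have h3 : ∫⁻ x in g • (V : Set G), φ (p x) ∂μ = ∫⁻ x in U, ‖W' (p x)‖ₑ ∂μ := by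
    have hVm : MeasurableSet (g • (V : Set G)) := (hVo.smul g).measurableSet
    rw [← lintegral_indicator hVm, ← lintegral_indicator hUo.measurableSet]
    refine lintegral_congr fun x => ?_
    by_cases hxV : x ∈ g • (V : Set G)
    · rw [indicator_of_mem hxV, hφ]
      by_cases hxU : x ∈ U
      · rw [indicator_of_mem (mem_image_of_mem p hxU), indicator_of_mem hxU]
      · have hpx : p x ∉ p '' U := by
          rintro ⟨u, hu, hux⟩
          exact hxU (hinj (hUV hu) hxV hux ▸ hu)
        rw [indicator_of_notMem hpx, indicator_of_notMem hxU]
    · rw [indicator_of_notMem hxV, indicator_of_notMem (fun h => hxV (hUV h))]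
  -- (iv) `W' ∘ p = W ∘ p` a.e. on `g V` for `μ`
  have h4 : ∫⁻ x in U, ‖W' (p x)‖ₑ ∂μ = ∫⁻ x in U, ‖W (p x)‖ₑ ∂μ := by
    set N : Set G' := toMeasurable μ' {y | W y ≠ W' y} with hN
    have hNm : MeasurableSet N := measurableSet_toMeasurable _ _
    have hN0 : μ' N = 0 := by rw [hN, measure_toMeasurable]; exact hWW'
    have hpre : (μ.restrict (g • (V : Set G))) (p ⁻¹' N) = 0 := by
      have hres : μ'.restrict (p g • (p '' (V : Set G))) N = 0 :=
        nonpos_iff_eq_zero.1 ((Measure.restrict_apply_le _ _).trans hN0.le)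
      rw [← Measure.map_apply hpm hNm, hmap g, Measure.smul_apply, hres, smul_zero]
    have hae : ∀ᵐ x ∂(μ.restrict (g • (V : Set G))), ‖W' (p x)‖ₑ = ‖W (p x)‖ₑ := by
      rw [ae_iff]
      refine measure_mono_null (fun x hx => ?_) hpre
      simp only [mem_setOf_eq] at hx ⊢
      have hne : W (p x) ≠ W' (p x) := fun h => hx (by rw [h])
      exact subset_toMeasurable _ _ hne
    exact lintegral_congr_ae (ae_restrict_of_ae_restrict_of_subset hUV hae)
  -- (v) assemble
  have hfin : (c : ℝ≥0∞) * ∫⁻ y in p g • (p '' (V : Set G)), φ y ∂μ' < ∞ := by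
    rw [← h2, h3, h4]
    exact (lintegral_mono_set (μ := μ) (f := fun x => ‖W (p x)‖ₑ) hUK).trans_lt (hW.integrableOn_isCompact hK).2
  rw [h1]
  exact ENNReal.lt_top_of_mul_ne_top_right hfin.ne hc0

end Covering

/-! ## §2  (b) Local integrability on `{X ∈ M_n(F) | IsUnit X}` gives local integrability on `GL_n(F)` -/

section GeneralLinear

variable {F : Type*} [Field F] [ValuativeRel F] [TopologicalSpace F] [IsNonarchimedeanLocalField F]
variable {n : Type*} [Fintype n] [DecidableEq n]
variable [MeasurableSpace (Matrix n n F)] [BorelSpace (Matrix n n F)] [MeasurableSpace (GL n F)] [BorelSpace (GL n F)]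

open Literature.NumberTheory.GaloisRepresentations Literature.NumberTheory.GaloisRepresentations.IsNonarchimedeanLocalField
open Literature.NumberTheory.Automorphic Literature.NumberTheory.Weil1964

omit [ValuativeRel F] [TopologicalSpace F] [IsNonarchimedeanLocalField F] [MeasurableSpace (Matrix n n F)] [BorelSpace (Matrix n n F)]
  [MeasurableSpace (GL n F)] [BorelSpace (GL n F)] in
/-- The invertible matrices are the range of `Units.val`. [folklore] -/
theorem setOf_isUnit_eq_range : {X : Matrix n n F | IsUnit X} = Set.range (Units.val : GL n F → Matrix n n F) :=
  Set.ext fun _ => ⟨fun h => ⟨h.unit, h.unit_spec⟩, fun ⟨u, hu⟩ => hu ▸ u.isUnit⟩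

/-- **(b) LOCAL INTEGRABILITY PASSES FROM THE OPEN SET `{X | IsUnit X} ⊆ M_n(F)` TO `GL_n(F)`**: for an additive Haar measure `dX` of `M_n(F)`, a Haar measure `ρ` of
`GL_n(F)` and `G : M_n(F) → E` locally `dX`-integrable ON the invertible matrices, `g ↦ G(↑g)` is locally `ρ`-integrable (Haar of `GL_n(F)` is
`a·‖det X‖⁻ⁿ dX`, and `‖det‖⁻ⁿ` is bounded on compact sets of invertible matrices). [cite: WeilBNT1967, Ch. I §4] [cite: HarishChandra1970, Part V §6 Thm. 15] -/
theorem locallyIntegrable_comp_coe (dX : Measure (Matrix n n F)) [dX.IsAddHaarMeasure] (ρ : Measure (GL n F)) [ρ.IsHaarMeasure]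
    {E : Type*} [NormedAddCommGroup E] {G : Matrix n n F → E} (hG : LocallyIntegrableOn G {X : Matrix n n F | IsUnit X} dX) :
    LocallyIntegrable (fun g : GL n F => G (g : Matrix n n F)) ρ := by
  classical
  haveI : T2Space F := (isLocalField F).toT2Space
  haveI : LocallyCompactSpace F := (isLocalField F).toLocallyCompactSpace
  haveI : SecondCountableTopology F := secondCountableTopology_localField F
  haveI : IsTopologicalRing F := inferInstance
  haveI : T2Space (Matrix n n F) := inferInstanceAs (T2Space (n → n → F))
  haveI : SecondCountableTopology (Matrix n n F) := inferInstanceAs (SecondCountableTopology (n → n → F))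
  haveI : LocallyCompactSpace (Matrix n n F) := inferInstanceAs (LocallyCompactSpace (n → n → F))
  haveI : SecondCountableTopology (GL n F) := (isOpenEmbedding_generalLinearGroup_val (m := n) (F := F)).isEmbedding.secondCountableTopology
  haveI : LocallyCompactSpace (GL n F) := (isOpenEmbedding_generalLinearGroup_val (m := n) (F := F)).locallyCompactSpace
  have hme : MeasurableEmbedding (Units.val : GL n F → Matrix n n F) := measurableEmbedding_generalLinearGroup_val
  -- the reference Haar measure and uniqueness
  set dens : Matrix n n F → ℝ≥0∞ := fun X => ((normAbs F X.det⁻¹ : ℝ≥0) : ℝ≥0∞) ^ Fintype.card n with hdens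
  have hdensm : Measurable dens := measurable_glDensity
  set ν₀ : Measure (GL n F) := Measure.comap (Units.val : GL n F → Matrix n n F) (dX.withDensity dens) with hν₀
  haveI : ν₀.IsHaarMeasure := isHaarMeasure_glHaar dX
  set a : ℝ≥0 := ρ.haarScalarFactor ν₀ with ha
  have hρ : ρ = a • ν₀ := isMulLeftInvariant_eq_smul ρ ν₀
  have hmapρ : ρ.map (Units.val : GL n F → Matrix n n F) = (a : ℝ≥0∞) • (dX.withDensity dens).restrict {X : Matrix n n F | IsUnit X} := by
    rw [hρ, Measure.map_smul, hν₀, hme.map_comap, setOf_isUnit_eq_range]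
    rfl
  -- the open set of invertible matrices
  have hUo : IsOpen {X : Matrix n n F | IsUnit X} := by
    rw [setOf_isUnit_eq_range]; exact (isOpenEmbedding_generalLinearGroup_val (m := n) (F := F)).isOpen_range
  intro g₀
  obtain ⟨K, hK, hg₀K, hKU⟩ := exists_compact_subset hUo (show ((g₀ : GL n F) : Matrix n n F) ∈ {X : Matrix n n F | IsUnit X} from g₀.isUnit)
  have hKm : MeasurableSet K := hK.isClosed.measurableSet
  have hGK : IntegrableOn G K dX := hG.integrableOn_compact_subset hKU hK
  refine ⟨Units.val ⁻¹' K, Units.continuous_val.continuousAt.preimage_mem_nhds (mem_interior_iff_mem_nhds.1 hg₀K), ?_⟩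
  -- the image of `ρ|_{val⁻¹ K}` under `val` is `a · dens · dX|_K`, absolutely continuous w.r.t. `dX|_K`
  have hmapK : (ρ.restrict (Units.val ⁻¹' K)).map (Units.val : GL n F → Matrix n n F) = (a : ℝ≥0∞) • ((dX.restrict K).withDensity dens) := by
    rw [← hme.restrict_map, hmapρ, Measure.restrict_smul, Measure.restrict_restrict hKm, inter_eq_left.2 hKU, restrict_withDensity hKm]
  have hac : (ρ.restrict (Units.val ⁻¹' K)).map (Units.val : GL n F → Matrix n n F) ≪ dX.restrict K := by
    rw [hmapK]
    exact (withDensity_absolutelyContinuous _ _).smul_left _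
  refine ⟨(hGK.1.mono_ac hac).comp_measurable hme.measurable, ?_⟩
  -- the density is bounded on `K`
  obtain ⟨X₀, -, hX₀⟩ := hK.exists_isMaxOn ⟨_, interior_subset hg₀K⟩ ((continuousOn_normAbs_det_inv (F := F) (n := n)).mono hKU)
  set M : ℝ≥0∞ := ((normAbs F X₀.det⁻¹ : ℝ≥0) : ℝ≥0∞) ^ Fintype.card n with hM
  have hMt : M ≠ ⊤ := ENNReal.pow_ne_top ENNReal.coe_ne_top
  have hdensle : ∀ X ∈ K, dens X ≤ M := fun X hX => by
    simp only [hdens, hM]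
    exact pow_le_pow_left' (ENNReal.coe_le_coe.2 (hX₀ hX)) _
  show ∫⁻ g, ‖G (g : Matrix n n F)‖ₑ ∂(ρ.restrict (Units.val ⁻¹' K)) < ∞
  calc ∫⁻ g, ‖G (g : Matrix n n F)‖ₑ ∂(ρ.restrict (Units.val ⁻¹' K))
      = ∫⁻ X, ‖G X‖ₑ ∂((ρ.restrict (Units.val ⁻¹' K)).map (Units.val : GL n F → Matrix n n F)) := by
        rw [hme.lintegral_map (fun X => ‖G X‖ₑ)]
    _ = (a : ℝ≥0∞) * ∫⁻ X, ‖G X‖ₑ ∂((dX.restrict K).withDensity dens) := by rw [hmapK, lintegral_smul_measure]; rfl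
    _ ≤ (a : ℝ≥0∞) * ∫⁻ X, (dens * fun X => ‖G X‖ₑ) X ∂(dX.restrict K) :=
        mul_le_mul' le_rfl (lintegral_withDensity_le_lintegral_mul _ hdensm _)
    _ ≤ (a : ℝ≥0∞) * ∫⁻ X, M * ‖G X‖ₑ ∂(dX.restrict K) :=
        mul_le_mul' le_rfl (setLIntegral_mono' hKm fun X hX => mul_le_mul' (hdensle X hX) le_rfl)
    _ = (a : ℝ≥0∞) * (M * ∫⁻ X in K, ‖G X‖ₑ ∂dX) := by rw [lintegral_const_mul' _ _ hMt]
    _ < ∞ := ENNReal.mul_lt_top ENNReal.coe_lt_top (ENNReal.mul_lt_top hMt.lt_top hGK.2)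

/-- (b), whole-space form: a function locally `dX`-integrable on all of `M_n(F)` restricts to a locally `ρ`-integrable function on `GL_n(F)`.
[cite: WeilBNT1967, Ch. I §4] -/
theorem locallyIntegrable_comp_coe_of_locallyIntegrable (dX : Measure (Matrix n n F)) [dX.IsAddHaarMeasure] (ρ : Measure (GL n F)) [ρ.IsHaarMeasure]
    {E : Type*} [NormedAddCommGroup E] {G : Matrix n n F → E} (hG : LocallyIntegrable G dX) :
    LocallyIntegrable (fun g : GL n F => G (g : Matrix n n F)) ρ :=
  locallyIntegrable_comp_coe dX ρ (hG.locallyIntegrableOn _)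

end GeneralLinear

end Summit.HodgeConjecture.HodgeConjecture.Cruxes.H413.K2E3HaarLocallyIntegrableTransport

end
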